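import Summits.HubbardSuperconductivity.HubbardSuperconductivity.Theorems.BalabanIRBirComplexStableXYRStubSectorNormalForm
import Literature.Analysis.FunctionSpaces.MinlosSazonovBound
import HarnessLib

/-!
# Crux `BirComplexStableXYR`, line `fat-gaussian-defect-calculus`: stub C1 `stub_bondGradientPrecision`

Registered stub (lead c8, wave 11, skeleton `Cruxes/BirComplexStableXYR/Lines/fat_gaussian_defect_calculus.lean`),
helper (`--supports`) for the crux `Summit.HubbardSuperconductivity.HubbardSuperconductivity.Theses.BalabanIR.BirComplexStableXYR`:
**precision bound for bond gradients under the pinned thin Gaussian.**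

**Statement.** With the window-Hessian matrix `H` of the thin form (its entries supplied by hypothesis `hH`, the matrix
of `thinForm_d0_eq_hessianForm`) and its pinned block `H' = H|_{Λ∖0}`: for `K > 0` and every bond `(x,i)` of the
space–time torus `Λ L M` (chart `TorusChart.piProdZMod 2 L M`), the functional `a_j = [j = x+e_i] − [j = x]` on `Λ∖0`
(so that `a·ψ = d₀(extZero ψ)(x,i)`) satisfies `aᵀ(K•H')⁻¹a ≤ 1/(2c₀K)`: the variance of a bond gradient under the thin
Gaussian `N(0,(K H')⁻¹)` is at most `1/(2c₀K)`.

**Proof.** (1) `a·t = d₀(extZero t)(x,i)` (an indicator against `t` on the punctured torus picks the value of the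
extension by zero). (2) A single bond is dominated by the gradient energy, `(d₀ t̂(x,i))² ≤ Σ_{x',i'} (d₀ t̂)²`, and the
coercivity of the thin form (`FSUnfolding.stub_thinFormCoercive`, (N)+(C)+`r ≥ 2`) together with the exact Hessian form
(`Theorems.thinForm_d0_eq_hessianForm`, under (U1)) gives `2c₀ Σ(d₀t̂)² ≤ t̂ᵀHt̂ = tᵀH't`
(`TorusChart.dotProduct_mulVec_extZero`); hence `(a·t)² ≤ (2c₀K)⁻¹ · tᵀ(K H')t`. (3) `K H'` is positive definite
(`TorusChart.posDef_submatrix_of_d₀_coercive`, `Matrix.PosDef.smul`), and the variational bound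
`MinlosSazonov.dotProduct_inv_mulVec_le` (take `t = (K H')⁻¹ a`) concludes. No definition, no named fact; sorry-free.
[folklore]
-/

set_option linter.dupNamespace false -- `Summit.<S>.<S>.Theorems…` repeats the summit name (D-0017 layout)

noncomputable section

namespace Summit.HubbardSuperconductivity.HubbardSuperconductivity.Theorems.FSUnfolding

open scoped BigOperators Matrix
open Literature.MathematicalPhysics.QuantumFieldTheory Literature.Probability.LatticeModels
open Literature.Analysis.FunctionSpaces
open Summit.HubbardSuperconductivity.BirComplexStableXYNegative

/-- An indicator of a site `y` integrated against a field `t` on the punctured torus is the value at `y` of the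
extension by zero of `t`. [folklore] -/
theorem bondGradPrec_sum_indicator_mul {Λ : Type*} [Fintype Λ] [DecidableEq Λ] [Zero Λ]
    (t : TorusChart.Punctured Λ → ℝ) (y : Λ) :
    ∑ j : TorusChart.Punctured Λ, (if j.1 = y then (1 : ℝ) else 0) * t j = TorusChart.extZero t y := by
  by_cases hy : y = 0
  · subst hy
    rw [TorusChart.extZero_zero]
    refine Finset.sum_eq_zero fun j _ => ?_
    rw [if_neg j.2, zero_mul]
  · rw [TorusChart.extZero_of_ne t hy, Fintype.sum_eq_single (⟨y, hy⟩ : TorusChart.Punctured Λ)]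
    · simp
    · intro j hj
      have : j.1 ≠ y := fun h => hj (Subtype.ext h)
      rw [if_neg this, zero_mul]

/-- The bond-gradient functional `a_j = [j = z] − [j = x]` on the punctured torus evaluates a field `t` to the
difference of the values of its extension by zero. [folklore] -/
theorem bondGradPrec_dotProduct_eq {Λ : Type*} [Fintype Λ] [DecidableEq Λ] [Zero Λ]
    (t : TorusChart.Punctured Λ → ℝ) (x z : Λ) :
    (fun j : TorusChart.Punctured Λ => (if j.1 = z then (1 : ℝ) else 0) - (if j.1 = x then (1 : ℝ) else 0)) ⬝ᵥ t =
      TorusChart.extZero t z - TorusChart.extZero t x := by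
  simp only [dotProduct, sub_mul, Finset.sum_sub_distrib, bondGradPrec_sum_indicator_mul]

/-- **stub C1 (lead c8, wave 11): precision bound for bond gradients under the pinned thin Gaussian.** [folklore] -/
theorem stub_bondGradientPrecision :
    ∀ (r : ℕ) (c : Table r) (c₀ : ℝ), 2 ≤ r → 0 < c₀ → (∀ n ∈ c.support, ∑ w, n w = 0) →
      c.sum (fun _ a => a) = 0 →
      (∀ φ : W r → ℝ, c₀ * ∑ w, ∑ w', (1 - Real.cos (φ w - φ w')) ≤ (genF c φ).re) →
      ∀ (L M : ℕ) [NeZero L] [NeZero M] (H : Matrix (Λ L M) (Λ L M) ℝ),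
      (∀ i j : Λ L M, H i j = (-(∑ k : Λ L M × ↥c.support, c k.2 *
          ((∑ w, ((k.2 : Freq r) w : ℝ) * (if sh L M k.1 w = i then (1 : ℝ) else 0) : ℝ) : ℂ) *
          ((∑ w, ((k.2 : Freq r) w : ℝ) * (if sh L M k.1 w = j then (1 : ℝ) else 0) : ℝ) : ℂ))).re) →
      ∀ (K : ℝ), 0 < K → ∀ (x : Λ L M) (i : Fin 3),
        (fun j : TorusChart.Punctured (Λ L M) =>
            (if j.1 = x + (TorusChart.piProdZMod 2 L M).gen i then (1 : ℝ) else 0) - (if j.1 = x then (1 : ℝ) else 0)) ⬝ᵥ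
          (K • H.submatrix Subtype.val Subtype.val :
              Matrix (TorusChart.Punctured (Λ L M)) (TorusChart.Punctured (Λ L M)) ℝ)⁻¹ *ᵥ
          (fun j : TorusChart.Punctured (Λ L M) =>
            (if j.1 = x + (TorusChart.piProdZMod 2 L M).gen i then (1 : ℝ) else 0) - (if j.1 = x then (1 : ℝ) else 0)) ≤
        1 / (2 * c₀ * K) := by
  intro r c c₀ hr hc₀ hU1 hN hC L M _ _ H hH K hK x i
  set F := TorusChart.piProdZMod 2 L M with hF
  -- the thin form is the `H`-form, `H` is symmetric, and the form is coercive on gradients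
  have hHeq : (Matrix.of fun i j : Λ L M => (-(∑ k : Λ L M × ↥c.support, c k.2 *
      ((∑ w, ((k.2 : Freq r) w : ℝ) * (if sh L M k.1 w = i then (1 : ℝ) else 0) : ℝ) : ℂ) *
      ((∑ w, ((k.2 : Freq r) w : ℝ) * (if sh L M k.1 w = j then (1 : ℝ) else 0) : ℝ) : ℂ))).re) = H := by
    ext i j
    rw [Matrix.of_apply, hH i j]
  have hsymm : H.IsSymm := sectorNormalForm_isSymm c H hH
  have hcoer : ∀ φ : Λ L M → ℝ, 2 * c₀ * ∑ x : Λ L M, ∑ i : Fin 3, (F.d₀ φ x i) ^ 2 ≤ φ ⬝ᵥ H *ᵥ φ := by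
    intro φ
    refine (stub_thinFormCoercive r c c₀ hr hc₀ hN hC L M (F.d₀ φ)).trans_eq ?_
    rw [hF, thinForm_d0_eq_hessianForm r c hU1 L M φ, hHeq]
  -- the pinned block, and its multiple `K • H'`, are positive definite
  have hpd : (H.submatrix Subtype.val Subtype.val :
      Matrix (TorusChart.Punctured (Λ L M)) (TorusChart.Punctured (Λ L M)) ℝ).PosDef :=
    TorusChart.posDef_submatrix_of_d₀_coercive F H hsymm (by positivity : (0 : ℝ) < 2 * c₀) hcoer
  have hpdK : (K • H.submatrix Subtype.val Subtype.val :
      Matrix (TorusChart.Punctured (Λ L M)) (TorusChart.Punctured (Λ L M)) ℝ).PosDef := hpd.smul hK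
  -- the variational bound `(a·t)² ≤ (2c₀K)⁻¹ · tᵀ(K H')t`
  refine MinlosSazonov.dotProduct_inv_mulVec_le hpdK (by positivity) fun t => ?_
  rw [bondGradPrec_dotProduct_eq, Matrix.smul_mulVec, dotProduct_smul, smul_eq_mul,
    ← TorusChart.dotProduct_mulVec_extZero]
  have h1 : (TorusChart.extZero t (x + F.gen i) - TorusChart.extZero t x) ^ 2 ≤
      ∑ x' : Λ L M, ∑ i' : Fin 3, (F.d₀ (TorusChart.extZero t) x' i') ^ 2 := by
    rw [← TorusChart.d₀_apply]
    refine le_trans ?_ (Finset.single_le_sum (fun y _ => Finset.sum_nonneg fun _ _ => sq_nonneg _)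
      (Finset.mem_univ x))
    exact Finset.single_le_sum (f := fun i' => (F.d₀ (TorusChart.extZero t) x i') ^ 2)
      (fun j _ => sq_nonneg _) (Finset.mem_univ i)
  have h2 := hcoer (TorusChart.extZero t)
  have h3 : (TorusChart.extZero t (x + F.gen i) - TorusChart.extZero t x) ^ 2 ≤
      (2 * c₀)⁻¹ * (TorusChart.extZero t ⬝ᵥ H *ᵥ TorusChart.extZero t) := by
    rw [le_inv_mul_iff₀ (by positivity : (0 : ℝ) < 2 * c₀)]
    exact (mul_le_mul_of_nonneg_left h1 (by positivity)).trans h2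
  calc (TorusChart.extZero t (x + F.gen i) - TorusChart.extZero t x) ^ 2
      ≤ (2 * c₀)⁻¹ * (TorusChart.extZero t ⬝ᵥ H *ᵥ TorusChart.extZero t) := h3
    _ = 1 / (2 * c₀ * K) * (K * (TorusChart.extZero t ⬝ᵥ H *ᵥ TorusChart.extZero t)) := by
      field_simp

end Summit.HubbardSuperconductivity.HubbardSuperconductivity.Theorems.FSUnfolding

end
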